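import Summits.MatrixMultiplication.MatrixMultiplication.Theorems.SoloInformedValInducedMatching

/-!
# The additive criterion for a union of two disjoint complete blocks

Solo-informed MatrixMultiplication, gen 77 (dossier `paper/val-superlinear.md` §15.8 (j)).

Setting: an abelian group `G`, identity potentials on `I = J = K = G`, and the tripartite pattern whose pair
graphs are unions of two complete bipartite pieces,
`H_IJ = X₁ × Y₁ ∪ X₂ × Y₂`, `H_JK = Y₁ × Z₁ ∪ Y₂ × Z₂`, `H_KI = Z₁ × X₁ ∪ Z₂ × X₂`
(the union of the two complete blocks `X₁ × Y₁ × Z₁` and `X₂ × Y₂ × Z₂`).  This is the shape of every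
superlinear accidental-free configuration known (`SoloInformedValTwoBlock`, `SoloInformedValTwoBlockMixed`).

Main result (`noAccidental_twoBlocks_iff`): if `X₁ ∩ X₂ = Y₁ ∩ Y₂ = Z₁ ∩ Z₂ = ∅`, the union has NO ACCIDENTAL
SOLUTIONS iff the purely additive conditions hold — each block satisfies the additive triple product property
`AddTPP` and each of the six non-constant patterns `(a,b,c) ∈ {1,2}³` is cross-free,
`0 ∉ (X_a − Y_a) + (Y_b − Z_b) + (Z_c − X_c)` (`CrossFree`).  The two directions are
`twoBlockAdditive_of_noAccidental` (uses disjointness) and `NoAccidental.of_twoBlockAdditive` (does not).  This is the statement decided,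
group by group and shape by shape, by the seat's SAT census of two-block configurations (kit job, gen 77):
an UNSAT answer there means that no two disjoint complete blocks of the given shapes form an accidental-free
configuration in that group.

Elementary; no `sorry`.
-/

namespace Summit.MatrixMultiplication.MatrixMultiplication.Theorems.SoloVal

open Finset

section TwoBlockCriterion

variable {G : Type*} [AddCommGroup G] [DecidableEq G]

/-- ADDITIVE TRIPLE PRODUCT PROPERTY of three finite sets of an abelian group (the accidental-freeness of one
complete block with identity potentials): `(x - y) + (y' - z) + (z' - x') = 0` with `x, x' ∈ X`, `y, y' ∈ Y`,
`z, z' ∈ Z` forces `x = x'`, `y = y'`, `z = z'`. -/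
def AddTPP (X Y Z : Finset G) : Prop :=
  ∀ ⦃x⦄, x ∈ X → ∀ ⦃x'⦄, x' ∈ X → ∀ ⦃y⦄, y ∈ Y → ∀ ⦃y'⦄, y' ∈ Y → ∀ ⦃z⦄, z ∈ Z → ∀ ⦃z'⦄, z' ∈ Z →
    (x - y) + (y' - z) + (z' - x') = 0 → x = x' ∧ y = y' ∧ z = z'

/-- CROSS-FREENESS of a pattern: no vanishing sum `(x - y) + (y' - z) + (z' - x')` with the `IJ`-edge `(x, y)`
from `Xa × Ya`, the `JK`-edge `(y', z)` from `Yb × Zb` and the `KI`-edge `(z', x')` from `Zc × Xc`; i.e.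
`0 ∉ (Xa − Ya) + (Yb − Zb) + (Zc − Xc)`. -/
def CrossFree (Xa Ya Yb Zb Zc Xc : Finset G) : Prop :=
  ∀ ⦃x⦄, x ∈ Xa → ∀ ⦃y⦄, y ∈ Ya → ∀ ⦃y'⦄, y' ∈ Yb → ∀ ⦃z⦄, z ∈ Zb → ∀ ⦃z'⦄, z' ∈ Zc → ∀ ⦃x'⦄, x' ∈ Xc →
    (x - y) + (y' - z) + (z' - x') ≠ 0

/-- The pair graph of a union of two complete bipartite pieces `A × B ∪ A' × B'`. -/
def blockPairs (A B A' B' : Finset G) : Finset (G × G) := A ×ˢ B ∪ A' ×ˢ B'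

omit [AddCommGroup G] in
/-- Membership in `blockPairs`: the pair lies in one of the two complete bipartite pieces. -/
theorem mem_blockPairs {A B A' B' : Finset G} {u v : G} :
    (u, v) ∈ blockPairs A B A' B' ↔ (u ∈ A ∧ v ∈ B) ∨ (u ∈ A' ∧ v ∈ B') := by
  simp [blockPairs, Finset.mem_union, Finset.mem_product]

/-- THE ADDITIVE CRITERION for the blocks `X₁ × Y₁ × Z₁`, `X₂ × Y₂ × Z₂`: both blocks have the additive TPP and
the six non-constant patterns `(1,1,2), (1,2,1), (1,2,2), (2,1,1), (2,1,2), (2,2,1)` are cross-free. -/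
def TwoBlockAdditive (X₁ Y₁ Z₁ X₂ Y₂ Z₂ : Finset G) : Prop :=
  AddTPP X₁ Y₁ Z₁ ∧ AddTPP X₂ Y₂ Z₂ ∧
    CrossFree X₁ Y₁ Y₁ Z₁ Z₂ X₂ ∧ CrossFree X₁ Y₁ Y₂ Z₂ Z₁ X₁ ∧ CrossFree X₁ Y₁ Y₂ Z₂ Z₂ X₂ ∧
    CrossFree X₂ Y₂ Y₁ Z₁ Z₁ X₁ ∧ CrossFree X₂ Y₂ Y₁ Z₁ Z₂ X₂ ∧ CrossFree X₂ Y₂ Y₂ Z₂ Z₁ X₁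

variable {X₁ Y₁ Z₁ X₂ Y₂ Z₂ : Finset G}

omit [DecidableEq G] in
/-- One complete block with identity potentials: accidental-freeness of the block on its own is `AddTPP`. -/
theorem noAccidental_block_iff {X Y Z : Finset G} :
    NoAccidental (id : G → G) id id (X ×ˢ Y) (Y ×ˢ Z) (Z ×ˢ X) ↔ AddTPP X Y Z := by
  constructor
  · intro hN x hx x' hx' y hy y' hy' z hz z' hz' h0
    exact hN x y y' z z' x' (Finset.mem_product.mpr ⟨hx, hy⟩) (Finset.mem_product.mpr ⟨hy', hz⟩)
      (Finset.mem_product.mpr ⟨hz', hx'⟩) h0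
  · intro h i j j' k k' i' hIJ hJK hKI h0
    rw [Finset.mem_product] at hIJ hJK hKI
    exact h hIJ.1 hKI.2 hIJ.2 hJK.1 hJK.2 hKI.1 h0

/-- FORWARD DIRECTION: an accidental-free union of two disjoint complete blocks satisfies the additive criterion. -/
theorem twoBlockAdditive_of_noAccidental
    (hX : Disjoint X₁ X₂) (hY : Disjoint Y₁ Y₂) (hZ : Disjoint Z₁ Z₂)
    (hN : NoAccidental (id : G → G) id id (blockPairs X₁ Y₁ X₂ Y₂) (blockPairs Y₁ Z₁ Y₂ Z₂)
      (blockPairs Z₁ X₁ Z₂ X₂)) :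
    TwoBlockAdditive X₁ Y₁ Z₁ X₂ Y₂ Z₂ := by
  have hX' : ∀ ⦃u⦄, u ∈ X₁ → u ∈ X₂ → False := fun u h1 h2 => Finset.disjoint_left.mp hX h1 h2
  have hY' : ∀ ⦃u⦄, u ∈ Y₁ → u ∈ Y₂ → False := fun u h1 h2 => Finset.disjoint_left.mp hY h1 h2
  have hZ' : ∀ ⦃u⦄, u ∈ Z₁ → u ∈ Z₂ → False := fun u h1 h2 => Finset.disjoint_left.mp hZ h1 h2
  refine ⟨?_, ?_, ?_, ?_, ?_, ?_, ?_, ?_⟩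
  · intro x hx x' hx' y hy y' hy' z hz z' hz' h0
    exact hN x y y' z z' x' (mem_blockPairs.mpr (Or.inl ⟨hx, hy⟩)) (mem_blockPairs.mpr (Or.inl ⟨hy', hz⟩))
      (mem_blockPairs.mpr (Or.inl ⟨hz', hx'⟩)) h0
  · intro x hx x' hx' y hy y' hy' z hz z' hz' h0
    exact hN x y y' z z' x' (mem_blockPairs.mpr (Or.inr ⟨hx, hy⟩)) (mem_blockPairs.mpr (Or.inr ⟨hy', hz⟩))
      (mem_blockPairs.mpr (Or.inr ⟨hz', hx'⟩)) h0
  · -- pattern (1,1,2): x ∈ X₁ but x' ∈ X₂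
    intro x hx y hy y' hy' z hz z' hz' x' hx' h0
    have h := hN x y y' z z' x' (mem_blockPairs.mpr (Or.inl ⟨hx, hy⟩)) (mem_blockPairs.mpr (Or.inl ⟨hy', hz⟩))
      (mem_blockPairs.mpr (Or.inr ⟨hz', hx'⟩)) h0
    exact hX' hx (h.1 ▸ hx')
  · -- pattern (1,2,1): y ∈ Y₁ but y' ∈ Y₂
    intro x hx y hy y' hy' z hz z' hz' x' hx' h0
    have h := hN x y y' z z' x' (mem_blockPairs.mpr (Or.inl ⟨hx, hy⟩)) (mem_blockPairs.mpr (Or.inr ⟨hy', hz⟩))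
      (mem_blockPairs.mpr (Or.inl ⟨hz', hx'⟩)) h0
    exact hY' hy (h.2.1 ▸ hy')
  · -- pattern (1,2,2): x ∈ X₁ but x' ∈ X₂
    intro x hx y hy y' hy' z hz z' hz' x' hx' h0
    have h := hN x y y' z z' x' (mem_blockPairs.mpr (Or.inl ⟨hx, hy⟩)) (mem_blockPairs.mpr (Or.inr ⟨hy', hz⟩))
      (mem_blockPairs.mpr (Or.inr ⟨hz', hx'⟩)) h0
    exact hX' hx (h.1 ▸ hx')
  · -- pattern (2,1,1): y ∈ Y₂ but y' ∈ Y₁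
    intro x hx y hy y' hy' z hz z' hz' x' hx' h0
    have h := hN x y y' z z' x' (mem_blockPairs.mpr (Or.inr ⟨hx, hy⟩)) (mem_blockPairs.mpr (Or.inl ⟨hy', hz⟩))
      (mem_blockPairs.mpr (Or.inl ⟨hz', hx'⟩)) h0
    exact hY' hy' (h.2.1 ▸ hy)
  · -- pattern (2,1,2): y ∈ Y₂ but y' ∈ Y₁
    intro x hx y hy y' hy' z hz z' hz' x' hx' h0
    have h := hN x y y' z z' x' (mem_blockPairs.mpr (Or.inr ⟨hx, hy⟩)) (mem_blockPairs.mpr (Or.inl ⟨hy', hz⟩))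
      (mem_blockPairs.mpr (Or.inr ⟨hz', hx'⟩)) h0
    exact hY' hy' (h.2.1 ▸ hy)
  · -- pattern (2,2,1): x ∈ X₂ but x' ∈ X₁
    intro x hx y hy y' hy' z hz z' hz' x' hx' h0
    have h := hN x y y' z z' x' (mem_blockPairs.mpr (Or.inr ⟨hx, hy⟩)) (mem_blockPairs.mpr (Or.inr ⟨hy', hz⟩))
      (mem_blockPairs.mpr (Or.inl ⟨hz', hx'⟩)) h0
    exact hX' hx' (h.1 ▸ hx)

/-- BACKWARD DIRECTION: the additive criterion implies that the union of the two blocks has no accidental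
solutions (no disjointness hypothesis is needed in this direction). -/
theorem NoAccidental.of_twoBlockAdditive
    (h : TwoBlockAdditive X₁ Y₁ Z₁ X₂ Y₂ Z₂) :
    NoAccidental (id : G → G) id id (blockPairs X₁ Y₁ X₂ Y₂) (blockPairs Y₁ Z₁ Y₂ Z₂)
      (blockPairs Z₁ X₁ Z₂ X₂) := by
  obtain ⟨t1, t2, c112, c121, c122, c211, c212, c221⟩ := h
  intro i j j' k k' i' hIJ hJK hKI h0
  rw [mem_blockPairs] at hIJ hJK hKI
  rcases hIJ with ⟨hi, hj⟩ | ⟨hi, hj⟩ <;> rcases hJK with ⟨hj', hk⟩ | ⟨hj', hk⟩ <;>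
    rcases hKI with ⟨hk', hi'⟩ | ⟨hk', hi'⟩
  · exact t1 hi hi' hj hj' hk hk' h0
  · exact absurd h0 (c112 hi hj hj' hk hk' hi')
  · exact absurd h0 (c121 hi hj hj' hk hk' hi')
  · exact absurd h0 (c122 hi hj hj' hk hk' hi')
  · exact absurd h0 (c211 hi hj hj' hk hk' hi')
  · exact absurd h0 (c212 hi hj hj' hk hk' hi')
  · exact absurd h0 (c221 hi hj hj' hk hk' hi')
  · exact t2 hi hi' hj hj' hk hk' h0

/-- THE CRITERION: for pairwise disjoint vertex classes, the union of the two complete blocks is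
accidental-free iff the additive criterion holds. -/
theorem noAccidental_twoBlocks_iff
    (hX : Disjoint X₁ X₂) (hY : Disjoint Y₁ Y₂) (hZ : Disjoint Z₁ Z₂) :
    NoAccidental (id : G → G) id id (blockPairs X₁ Y₁ X₂ Y₂) (blockPairs Y₁ Z₁ Y₂ Z₂)
      (blockPairs Z₁ X₁ Z₂ X₂) ↔ TwoBlockAdditive X₁ Y₁ Z₁ X₂ Y₂ Z₂ :=
  ⟨twoBlockAdditive_of_noAccidental hX hY hZ, NoAccidental.of_twoBlockAdditive⟩

/-- The disjointness hypotheses are used: without them cross patterns may vanish legitimately.  What the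
criterion does NOT need is any hypothesis on the sizes — e.g. it holds verbatim for the rotated axis blocks of
`SoloInformedValTwoBlockMixed` (there the six cross conditions are the 'eight-pattern argument'). As a sanity
instance: two disjoint one-point blocks `{a} × {b} × {c}`, `{a'} × {b'} × {c'}` are jointly accidental-free iff
the six cross sums are non-zero; here is the smallest case `G = ZMod 2`, blocks `{0}³` and `{1}³`, where the
pattern `(1,1,2)` sum `(0-0)+(0-0)+(1-1)` vanishes, so the union is NOT accidental-free although each block is. -/
theorem twoPoints_not_noAccidental :
    ¬ NoAccidental (id : ZMod 2 → ZMod 2) id id (blockPairs {0} {0} {1} {1}) (blockPairs {0} {0} {1} {1})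
      (blockPairs {0} {0} {1} {1}) := by
  intro hN
  have h := (twoBlockAdditive_of_noAccidental (by decide) (by decide) (by decide) hN).2.2.1
  exact h (Finset.mem_singleton_self 0) (Finset.mem_singleton_self 0) (Finset.mem_singleton_self 0)
    (Finset.mem_singleton_self 0) (Finset.mem_singleton_self 1) (Finset.mem_singleton_self 1) (by decide)

end TwoBlockCriterion

end Summit.MatrixMultiplication.MatrixMultiplication.Theorems.SoloVal
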